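import Summits.BirchSwinnertonDyer.BirchSwinnertonDyer.Theses.LeadingTerm
import Summits.BirchSwinnertonDyer.BirchSwinnertonDyer.Theses.PAdicOrderV2
import Summits.BirchSwinnertonDyer.BirchSwinnertonDyer.Theorems.LeadingTermPinchPrimeSchneiderShaOfPinchAtKato
import Summits.BirchSwinnertonDyer.BirchSwinnertonDyer.Theorems.LeadingTermPinchPrimeOpenStubsOfResidual
import Summits.BirchSwinnertonDyer.BirchSwinnertonDyer.Theorems.PAdicOrderV2PadicBSDrankNoExcessOfMainConjecture
import Summits.BirchSwinnertonDyer.BirchSwinnertonDyer.Theorems.PAdicOrderV2PAdicOrderThesisR2StubResidualSectorsItems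

/-!
# Crux `PinchPrime` (stmt-BirchSwinnertonDyer-16218) — line `SketchIdeator2`, stub G15
# `stub_orderEqRank_of_schneiderSha_mainConjecture` (GLUE: pointwise SUFFICIENCY of the same-prime
# pair at ANY good ordinary `p ≥ 5`, residually reducible primes included, from the main-conjecture
# ITEM stmt-15426) and the ITEM-LEVEL CONTENT THEOREM `PinchPrime ⟺ SchneiderSha somewhere`

Registered stub of the lead skeleton `Cruxes/PinchPrime/Lines/SketchIdeator2.lean` (v27, lead c6,
line cycle 7). It closes the IRREDUCIBILITY GAP left by cycles 5–6: the landed sufficiency bridge G1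
`stub_orderEqRankOfSchneiderShaAt` (p134300) needs `E[p]` irreducible at the witness prime because
it takes the main conjecture from the Literature fact
`burungale_castella_skinner_charIdeal_eq_padicLFunction` (BCS 2025, `ρ̄` irreducible), while the
landed necessity G13 `stub_schneiderSha_of_pinchAt_kato` (p139782) has no such demand — so the crux
was pinned between (J, S″) and (J⁻, S″⁻) with `E[p]`-irreducibility as the gap. The sibling route
`PAdicOrderV2` carries the main conjecture at EVERY good ordinary `p ≥ 3` as a route ITEM,
`PAdicOrderV2.PAdicOrderMainConjectureR7` (stmt-BirchSwinnertonDyer-15426: `X` torsion,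
`char_Λ X = (g)`, `ι g = p^k · L_p(f, α_p, T)`; in print on the Skinner–Urban / BCS /
Castella–Grossi–Skinner loci, open beyond), and Kato's divisibility as the shared ITEM
`KatoDivisibility` (stmt-BirchSwinnertonDyer-18082, Kato 2004 Thm. 17.4 (1)–(2), in print). Modulo
these two ITEMS and two PUBLISHED THEOREMS (Perrin-Riou–Schneider `Schneider1985_order_charGenerator`,
modularity `exists_isNewformOf`) the crux is EXACTLY the same-prime statement, with no
irreducibility, no analytic rank, no GZK, no Bertrand:

  `LeadingTerm.PinchPrime ⟺ ∀ E/ℚ, ∃ good ordinary p ≥ 5, #Ш(E/ℚ)[p^∞] < ∞ ∧ Reg_p(E) ≠ 0`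
  (`PinchPrime_iff_schneiderSha_somewhere_of_items`).

* `stub_orderEqRank_of_schneiderSha_mainConjecture` (G15): stmt-15426 → PRS → at `(W, p)` with
  `p ≥ 5` good ordinary, `Ш[p^∞]` finite and every canonical datum non-degenerate, EVERY newform `f`
  of `W` has `ord_{T=0} L_p(f, α_p, T) = rank_ℤ E(ℚ)`: PRS clause 2 gives `ord g = rank` for the
  generator `g` of `char X` supplied by the item, and `ord L_p = ord (p^k L_p) = ord (ι g) = ord g`
  (`order_iwasawaToPowerSeries`, landed in the sibling route).
* `pinchAt_iff_schneiderSha_of_items`: at `p ≥ 5` good ordinary and a newform `f`, the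
  `(W, p)`-instance of the crux ⟺ the same-prime pair (→ Kato item via the sibling route's landed
  `schneiderSha_of_orderEqRank_katoDivisibility`; ← G15).
* `PinchPrime_iff_schneiderSha_somewhere_of_items`: the displayed equivalence.
Compare the refuter's `Negative/ContentOfCrux.leadingTermPinchPrime_iff_schneiderSha_somewhere`
(the same modulo an inline ORDER main conjecture `ord_T L_p = ord_T f_E` at every good ordinary
`p ≥ 5` and an Iwasawa-datum hypothesis) and the landed `pinchAt_iff_schneiderSha_of_irreducible_kato`
(G13 file; irreducible primes only): here both directions rest on route ITEMS, so the equivalence is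
an edge of the obligation graph — closing stmt-15426 ∧ stmt-18082 makes the crux literally
"SchneiderSha somewhere", and the children A′ (17976) × S′ (17975) are one allocation of its two
halves (cofinite × infinitely often).

References: Kato, Astérisque 295 (2004), Thm. 17.4; Skinner–Urban 2014 Thm. 3.6.9;
Burungale–Castella–Skinner 2025 Thm. 1.1.2; Balakrishnan–Müller–Stein, Math. Comp. 85 (2016),
Thm. 1.7; Mazur–Stein–Tate 2006, §1 and Conj. 1.1; Mazur–Tate–Teitelbaum 1986, §I.12.
-/

noncomputable section

-- D-0017: single-problem summit, so `Summit.BirchSwinnertonDyer.BirchSwinnertonDyer.…` repeats a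
-- namespace BY DESIGN.
set_option linter.dupNamespace false

namespace Summit.BirchSwinnertonDyer.BirchSwinnertonDyer.Cruxes.PinchPrime.FirstLayerStability

open scoped MatrixGroups ModularForm
open CongruenceSubgroup Literature.NumberTheory.EllipticCurves
  Literature.NumberTheory.EllipticCurves.ModularForms
open Summit.BirchSwinnertonDyer.BirchSwinnertonDyer.Theses
open Summit.BirchSwinnertonDyer.BirchSwinnertonDyer.Cruxes.PAdicOrderThesisR2.LambdaAdicGZ

/-- **`ord_{T=0} (p^k · L) = ord_{T=0} L`** in `ℚ_p⟦T⟧` for `k ∈ ℤ` (the constant `p^k` is a unit).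
[folklore] -/
theorem order_C_zpow_mul (p : ℕ) [Fact p.Prime] (k : ℤ) (L : PowerSeries ℚ_[p]) :
    (PowerSeries.C ((p : ℚ_[p]) ^ k) * L).order = L.order := by
  have hpk : IsUnit (PowerSeries.C ((p : ℚ_[p]) ^ k)) := by
    refine IsUnit.map PowerSeries.C (IsUnit.mk0 _ (zpow_ne_zero k ?_))
    exact_mod_cast (Fact.out : p.Prime).ne_zero
  rw [PowerSeries.order_mul, PowerSeries.order_zero_of_unit hpk, zero_add]

/-- **STUB G15 `stub_orderEqRank_of_schneiderSha_mainConjecture` (GLUE, v27): pointwise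
sufficiency of the same-prime pair at ANY good ordinary `p ≥ 5` — residually reducible primes
included — from the main-conjecture ITEM of the sibling route.** If
`PAdicOrderV2.PAdicOrderMainConjectureR7` (stmt-BirchSwinnertonDyer-15426) and Perrin-Riou–Schneider
hold, then for `E/ℚ` elliptic (globally minimal `W`), `p ≥ 5` good ordinary with `Ш(E/ℚ)[p^∞]`
finite and every canonical cyclotomic height datum non-degenerate, every newform `f` of `W` has
`ord_{T=0} L_p(f, α_p, T) = rank_ℤ E(ℚ)`: on the cyclotomic datum and the (finitely generated)
Iwasawa datum the item gives `X` torsion, `char X = (g)`, `ι g = p^k L_p`; PRS clause 2 at the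
canonical datum of `exists_isCanonical_holds` gives `ord g = rank`; and
`ord L_p = ord (p^k L_p) = ord (ι g) = ord g`. [cite: BalakrishnanMullerStein2015, Thm. 1.7]
[cite: SkinnerUrban2014, Thm. 3.6.9] [cite: MazurTateTeitelbaum1986Invent, §I.12] -/
theorem stub_orderEqRank_of_schneiderSha_mainConjecture :
    PAdicOrderV2.PAdicOrderMainConjectureR7 → Schneider1985_order_charGenerator →
    ∀ (W : WeierstrassCurve ℚ) [W.IsElliptic] [W.IsGloballyMinimal] (p : ℕ) [Fact p.Prime],
      5 ≤ p → IsOrdinaryAt W p → Finite (AddCommGroup.primaryComponent W.sha p) →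
      (∀ Dh : WeierstrassCurve.PAdicHeightData W p, Dh.IsCanonical →
        WeierstrassCurve.SchneiderConjecture Dh) →
      ∀ {N : ℕ} [NeZero N] (f : CuspForm (Gamma0 N) 2), IsNewformOf W f →
        (padicLFunction f (unitRoot W p : ℚ_[p])).order = W.mordellWeilRank := by
  intro hMC hPRS W _ _ p _ h5 hord hsha hSch N _ f hf
  obtain ⟨κ, hκ, γ, hγ, hγ'⟩ := exists_isCyclotomic_isTopGenerator_isCyclotomicVariable_holds p
  obtain ⟨D⟩ := W.nonempty_selmerDualData_holds κ γ hγ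
  haveI : Module.Finite (IwasawaAlgebra p) D.X := D.module_finite_of_isCyclotomic W κ hκ hγ
  obtain ⟨hX, g, k, hg, hιg⟩ := hMC W p (by omega) hord.1 hord.2 κ γ hκ hγ hγ' f hf D
  obtain ⟨Dh, hDh⟩ := WeierstrassCurve.exists_isCanonical_holds W p h5 hord.1 hord.2
  have hgord : g.order = W.mordellWeilRank :=
    (hPRS.order_eq_iff h5 hord.1 hord.2 hκ hγ hγ' D hX hg hDh).mpr ⟨hSch Dh hDh, hsha⟩
  have hL : (padicLFunction f (unitRoot W p : ℚ_[p])).order = g.order := by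
    rw [← Theorems.order_iwasawaToPowerSeries p g, hιg, order_C_zpow_mul]
  rw [hL, hgord]

/-- **At `p ≥ 5` good ordinary and a newform `f`, the `(W, p)`-instance of the crux is EQUIVALENT to
the same-prime pair, modulo the two ITEMS stmt-15426 (main conjecture ∀p) and stmt-18082 (Kato's
divisibility) and Perrin-Riou–Schneider** — no irreducibility of `E[p]`:
`ord_{T=0} L_p(f, α_p, T) = rank_ℤ E(ℚ) ⟺ #Ш(E/ℚ)[p^∞] < ∞ ∧ (every canonical Dh has Reg_p ≠ 0)`.
(→ the sibling route's landed `schneiderSha_of_orderEqRank_katoDivisibility`, Kato in the item's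
two-clause shape + PRS; ← G15.) [cite: BalakrishnanMullerStein2015, Thm. 1.7]
[cite: Kato2004Asterisque, Thm. 17.4 (p. 273)] -/
theorem pinchAt_iff_schneiderSha_of_items
    (hMC : PAdicOrderV2.PAdicOrderMainConjectureR7) (hK : LeadingTerm.KatoDivisibility)
    (hPRS : Schneider1985_order_charGenerator)
    (W : WeierstrassCurve ℚ) [W.IsElliptic] [W.IsGloballyMinimal] (p : ℕ) [Fact p.Prime]
    {N : ℕ} [NeZero N] (f : CuspForm (Gamma0 N) 2)
    (h5 : 5 ≤ p) (hord : IsOrdinaryAt W p) (hf : IsNewformOf W f) :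
    (padicLFunction f (unitRoot W p : ℚ_[p])).order = W.mordellWeilRank ↔
      (Finite (AddCommGroup.primaryComponent W.sha p) ∧
        ∀ Dh : WeierstrassCurve.PAdicHeightData W p, Dh.IsCanonical →
          WeierstrassCurve.SchneiderConjecture Dh) := by
  have hK' : PAdicOrderV2.KatoDivisibility :=
    (Iff.rfl : LeadingTerm.KatoDivisibility ↔ PAdicOrderV2.KatoDivisibility).mp hK
  constructor
  · exact schneiderSha_of_orderEqRank_katoDivisibility hPRS hK' W p f h5 hord hf
  · rintro ⟨hsha, hSch⟩
    exact stub_orderEqRank_of_schneiderSha_mainConjecture hMC hPRS W p h5 hord hsha hSch f hf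

/-- **The crux from the same-prime pair somewhere, modulo the main-conjecture ITEM stmt-15426,
Perrin-Riou–Schneider and modularity** — no irreducibility, no analytic rank, no GZK, no Bertrand
(compare the landed G12 `stub_pinchAt_of_samePrime`, which needs `E[p]` irreducible at the witness
and splits by analytic rank). [cite: BalakrishnanMullerStein2015, Thm. 1.7] [cite: MazurSteinTate2006, Conj. 1.1] -/
theorem PinchPrime_of_schneiderSha_somewhere_of_items
    (hMC : PAdicOrderV2.PAdicOrderMainConjectureR7) (hPRS : Schneider1985_order_charGenerator)
    (hmod : exists_isNewformOf)
    (h : ∀ (W : WeierstrassCurve ℚ) [W.IsElliptic] [W.IsGloballyMinimal],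
      ∃ (p : ℕ) (_ : Fact p.Prime), 5 ≤ p ∧ IsOrdinaryAt W p ∧
        Finite (AddCommGroup.primaryComponent W.sha p) ∧
        ∀ Dh : WeierstrassCurve.PAdicHeightData W p, Dh.IsCanonical →
          WeierstrassCurve.SchneiderConjecture Dh) :
    LeadingTerm.PinchPrime := by
  intro W _ _
  haveI : NeZero (W.conductorNorm ℤ) := ⟨(WeierstrassCurve.conductorNorm_pos_holds (W := W)).ne'⟩
  obtain ⟨f, hf⟩ := hmod W
  obtain ⟨p, hp, h5, hord, hsha, hSch⟩ := h W
  obtain ⟨D, hD⟩ := WeierstrassCurve.exists_isCanonical_holds W p h5 hord.1 hord.2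
  exact ⟨p, hp, h5, hord, D, hD, W.conductorNorm ℤ, inferInstance, f, hf,
    stub_orderEqRank_of_schneiderSha_mainConjecture hMC hPRS W p h5 hord hsha hSch f hf⟩

/-- **ITEM-LEVEL CONTENT THEOREM.** Modulo the two route ITEMS
`PAdicOrderV2.PAdicOrderMainConjectureR7` (stmt-15426) and `LeadingTerm.KatoDivisibility`
(stmt-18082) and the two published theorems Perrin-Riou–Schneider and modularity (named facts), the
crux `LeadingTerm.PinchPrime` is EQUIVALENT to: every elliptic `E/ℚ` (globally minimal `W`) has a
good ordinary `p ≥ 5` with `Ш(E/ℚ)[p^∞]` finite and every canonical cyclotomic `p`-adic height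
datum non-degenerate. (→ at the pinch prime itself, by Kato + PRS; ← G15 + modularity.)
[cite: BalakrishnanMullerStein2015, Thm. 1.7] [cite: Kato2004Asterisque, Thm. 17.4 (p. 273)]
[cite: MazurSteinTate2006, Conj. 1.1] -/
theorem PinchPrime_iff_schneiderSha_somewhere_of_items
    (hMC : PAdicOrderV2.PAdicOrderMainConjectureR7) (hK : LeadingTerm.KatoDivisibility)
    (hPRS : Schneider1985_order_charGenerator) (hmod : exists_isNewformOf) :
    LeadingTerm.PinchPrime ↔
      ∀ (W : WeierstrassCurve ℚ) [W.IsElliptic] [W.IsGloballyMinimal],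
        ∃ (p : ℕ) (_ : Fact p.Prime), 5 ≤ p ∧ IsOrdinaryAt W p ∧
          Finite (AddCommGroup.primaryComponent W.sha p) ∧
          ∀ Dh : WeierstrassCurve.PAdicHeightData W p, Dh.IsCanonical →
            WeierstrassCurve.SchneiderConjecture Dh := by
  refine ⟨fun hS W _ _ ↦ ?_, PinchPrime_of_schneiderSha_somewhere_of_items hMC hPRS hmod⟩
  obtain ⟨p, hp, h5, hord, -, -, N, hN, f, hf, horder⟩ := hS W
  exact ⟨p, hp, h5, hord, (pinchAt_iff_schneiderSha_of_items hMC hK hPRS W p f h5 hord hf).mp horder⟩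

end Summit.BirchSwinnertonDyer.BirchSwinnertonDyer.Cruxes.PinchPrime.FirstLayerStability

end
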